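import Summits.BirchSwinnertonDyer.BirchSwinnertonDyer.Theorems.EisensteinPrimesResidualPairStableLine
import Summits.BirchSwinnertonDyer.BirchSwinnertonDyer.Theorems.EisensteinPrimesAnomalousLocalMover
import Summits.BirchSwinnertonDyer.BirchSwinnertonDyer.Theorems.EisensteinPrimesResidualStrictEqUnramifiedChar
import Summits.BirchSwinnertonDyer.BirchSwinnertonDyer.Theorems.EisensteinPrimesShapiroBridgeModel
import Summits.BirchSwinnertonDyer.BirchSwinnertonDyer.Theorems.EisensteinPrimesCharLocalInertiaFrobenius
import HarnessLib

/-!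
# Crux `GoodLatticeBDPValue` (stmt-BirchSwinnertonDyer-19032), line `halves` v20.1, stub `stub_indexPlumbing`
# (B2): `ω̃ = θsub` IS RAMIFIED AT `v̄`, and the non-primitive and strict groups of `(F/𝒪)(θsub)` have the
# same corank (the hypothesis `hBsub` of `IndexPlumbingShell.lambdaIdentity_of_mid_of_nrVsStrict`, p649775)

Width seat bsd-line-x1-p1-w5 (gen 0, 2026-08-28). Seat w4 gen 3 proved `grSelmer = unrSelmer` for a character
RAMIFIED at `v̄` (`CharResidualSelmerCount.grSelmer_charModule_eq_unrSelmer_of_ramified`, hypothesis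
`∃ τ ∈ I_v̄, unitChar θ τ ≠ 1`); the residual-pair line is MOVED by `I_v̄` at a good anomalous prime (seat w2 gen 3,
`AnomalousLocalTorsion.exists_mem_inertia_smul_ne`, KY "`ω` is ramified"). This file joins them at the crux's
binders: from `IsResidualPairOver E_K p θsub θquot` (LEAD g3's `ResidualPairStableLine.exists_stableLine_of_isResidualPairOver`
gives the line with an equivariant embedding into `(F/𝒪)(θsub)`), the mover yields `τ ∈ I_v̄` with `θsub(τ) ≠ 1`
(`exists_mem_inertia_unitChar_ne_one_of_isResidualPairOver`), whence
`zpCorank S^{S₀}_nr(θsub) = zpCorank R(θsub)` — in the Greenberg–Vatsal spelling of the shell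
(`zpCorank_datumSelmerInfty_eq_datumStrictSelmer_of_isResidualPairOver`), for EVERY `ℤ_p`-extension `κ` and `S₀`.

No new definition, no named fact, no `sorry`; no statement of the crux / KY Thm. 1.4.1 is proved here.

References: T. Keller, M. Yin, arXiv:2402.12781v2, §1.3 (TeX L1040–1044) and proof of Lemma 1.2.4 (L790–795);
J.-P. Serre, Invent. Math. 15 (1972), §1.11.
-/

-- D-0017: single-problem summit, the namespace repeats the problem name by design.
set_option linter.dupNamespace false
set_option autoImplicit false

noncomputable section

open scoped Classical

open NumberField IsDedekindDomain Field WeierstrassCurve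
open Literature.NumberTheory.EllipticCurves Literature.NumberTheory.EllipticCurves.GreenbergSelmer
  Literature.NumberTheory.EllipticCurves.GreenbergVatsal2000 Literature.NumberTheory.GaloisRepresentations
  Literature.NumberTheory.EllipticCurves.KellerYin2024 Literature.NumberTheory.EllipticCurves.Rank1Residual
  Literature.NumberTheory.EllipticCurves.Castella2018

namespace Summit.BirchSwinnertonDyer.BirchSwinnertonDyer.Theorems.IndexPlumbingSubNrEqStrict

open Summit.BirchSwinnertonDyer.BirchSwinnertonDyer.Theorems
  Summit.BirchSwinnertonDyer.Rank1Residual.X2.ResidualDevissageModules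

variable (W : WeierstrassCurve ℚ) [W.IsElliptic] [W.IsGloballyMinimal] {p : ℕ} [Fact p.Prime]
  {K : Type} [Field K] [NumberField K]

/-- **`ω̃ = θsub` is ramified at `v̄`**: at the crux's data (`p` odd, good ANOMALOUS, every rational line ramified at
`p`, `K` imaginary quadratic, `p = v v̄`), for a residual pair `(θsub, θquot)` of `E_K[p]` some `τ ∈ I_v̄` has
`unitChar θsub τ ≠ 1`. Proof: the stable line `Φ` of the pair embeds equivariantly into `(F/𝒪)(θsub)`
(`exists_stableLine_of_isResidualPairOver`); it is moved by some `τ ∈ I_v̄` (`exists_mem_inertia_smul_ne`); if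
`θsub(τ) = 1` then `τ` fixes `(F/𝒪)(θsub)` (`smul_eq_self_of_apply_eq_one`), hence `Φ` — contradiction.
(KY: "`ω` is ramified", TeX L1043.) [cite: KellerYin2024, §1.3–1.4 (arXiv:2402.12781v2 TeX L1043, L1063–1086)]
[cite: Serre1972, §1.11 Prop. 11 and Cor.] -/
theorem exists_mem_inertia_unitChar_ne_one_of_isResidualPairOver (hp2 : p ≠ 2) (hanom : Anom W p)
    (hGL : ∀ Φ : AddSubgroup (geomTorsion W (p : ℤ)), IsRationalLine W p Φ → ¬ LineUnramifiedAt W p Φ)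
    (hK : IsImaginaryQuadratic K) {v vbar : HeightOneSpectrum (𝓞 K)} (hpv : ((p : ℕ) : 𝓞 K) ∈ v.asIdeal)
    (hpvbar : ((p : ℕ) : 𝓞 K) ∈ vbar.asIdeal) (hne : vbar ≠ v)
    {θsub θquot : FramedGaloisRep K (padicCoeffIntegers (∅ : Set (PadicAlgCl p))) 1}
    (hpair : IsResidualPairOver (W.baseChange K) p θsub θquot) :
    ∃ τ ∈ GreenbergSelmer.inertia vbar, unitChar θsub τ ≠ 1 := by
  haveI hEK : (W.baseChange K).IsElliptic := inferInstanceAs (W.map (algebraMap ℚ K)).IsElliptic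
  obtain ⟨Φ, hΦS, -, ⟨j, hj, hjinj, -⟩, -⟩ :=
    ResidualPairStableLine.exists_stableLine_of_isResidualPairOver (W.baseChange K) hpair
  -- the line as a subgroup of `E(K̄)`
  set Ψ : AddSubgroup (geomPoints (W.baseChange K)) :=
    Φ.toAddSubgroup.map ((W.baseChange K).geomTorsion (p : ℤ)).subtype with hΨ
  have hΨle : Ψ ≤ geomTorsion (W.baseChange K) (p : ℤ) := AddSubgroup.map_subtype_le _
  have hΨcard : Nat.card Ψ = p := by
    rw [← hΦS]
    exact Nat.card_congr ((Φ.toAddSubgroup.equivMapOfInjective _ Subtype.val_injective).symm.toEquiv)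
  have hΨstab : ∀ (σ : absoluteGaloisGroup K), ∀ P ∈ Ψ, σ • P ∈ Ψ := fun σ P hP ↦ by
    obtain ⟨m, hm, rfl⟩ := AddSubgroup.mem_map.mp hP
    exact AddSubgroup.mem_map.mpr ⟨σ • m, Φ.smul_mem' σ hm,
      Literature.NumberTheory.EllipticCurves.AddSubgroup.torsionBy.coe_smul σ m⟩
  obtain ⟨τ, hτ, P, hP, hmove⟩ :=
    AnomalousLocalTorsion.exists_mem_inertia_smul_ne W hp2 hanom hGL hK hpv hpvbar hne hΨle hΨcard hΨstab
  refine ⟨τ, hτ, fun h1 ↦ hmove ?_⟩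
  have hθ1 : θsub τ = 1 := (GreenbergFullAtSelmer.unitChar_eq_one_iff θsub τ).mp h1
  obtain ⟨m, hm, rfl⟩ := AddSubgroup.mem_map.mp hP
  -- `τ` fixes the corresponding element `a` of `Φ.Sub` (`Φ.incl a = m`)
  let a : Φ.Sub := ⟨m, hm⟩
  have hfix : τ • a = a := hjinj (by
    rw [hj, CharLocalInertiaFrobenius.smul_eq_self_of_apply_eq_one θsub hθ1])
  have h : τ • Φ.incl a = Φ.incl a := by rw [← StableSubgroup.incl_smul, hfix]
  -- in `E(K̄)`: `↑(τ • m) = τ • ↑m`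
  change τ • ((m : (W.baseChange K).geomTorsion (p : ℤ)) : geomPoints (W.baseChange K)) =
    ((m : (W.baseChange K).geomTorsion (p : ℤ)) : geomPoints (W.baseChange K))
  rw [← Literature.NumberTheory.EllipticCurves.AddSubgroup.torsionBy.coe_smul τ m]
  exact congrArg (fun x : (W.baseChange K).geomTorsion (p : ℤ) ↦ (x : geomPoints (W.baseChange K))) h

/-- **(B2) of `stub_indexPlumbing`: `zpCorank S^{S₀}_nr(θsub) = zpCorank R(θsub)`** in the Greenberg–Vatsal spelling
(`datumSelmerInfty κ (F/𝒪)(θsub) (bdpData … vbar) S₀` versus `datumStrictSelmer (ker κ) (F/𝒪)(θsub) p (bdpData … vbar) S₀`;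
`unrSelmer`/`grSelmer` unfold to these), for EVERY `ℤ_p`-extension `κ` of `K` and every `S₀`: the two groups are
EQUAL because `θsub` is ramified at `v̄` (`grSelmer_charModule_eq_unrSelmer_of_ramified`, seat w4 gen 3) — the
`hBsub` hypothesis of `IndexPlumbingShell.lambdaIdentity_of_mid_of_nrVsStrict`.
[cite: KellerYin2024, proof of Lemma 1.2.4 and §1.4 (arXiv:2402.12781v2 TeX L790–795, L1240–1260)] -/
theorem zpCorank_datumSelmerInfty_eq_datumStrictSelmer_of_isResidualPairOver (hp2 : p ≠ 2) (hanom : Anom W p)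
    (hGL : ∀ Φ : AddSubgroup (geomTorsion W (p : ℤ)), IsRationalLine W p Φ → ¬ LineUnramifiedAt W p Φ)
    (hK : IsImaginaryQuadratic K) {v vbar : HeightOneSpectrum (𝓞 K)} (hpv : ((p : ℕ) : 𝓞 K) ∈ v.asIdeal)
    (hpvbar : ((p : ℕ) : 𝓞 K) ∈ vbar.asIdeal) (hne : vbar ≠ v)
    {θsub θquot : FramedGaloisRep K (padicCoeffIntegers (∅ : Set (PadicAlgCl p))) 1}
    (hpair : IsResidualPairOver (W.baseChange K) p θsub θquot) (κ : ZpExtension K p)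
    (S₀ : Set (HeightOneSpectrum (𝓞 K))) :
    zpCorank (datumSelmerInfty κ (charModule (∅ : Set (PadicAlgCl p)) θsub)
        (AcSelmer.bdpData (charModule (∅ : Set (PadicAlgCl p)) θsub) p vbar) S₀) p =
      zpCorank (datumStrictSelmer κ.kerSubgroup (charModule (∅ : Set (PadicAlgCl p)) θsub) p
        (AcSelmer.bdpData (charModule (∅ : Set (PadicAlgCl p)) θsub) p vbar) S₀) p := by
  obtain ⟨τ, hτ, hne1⟩ :=
    exists_mem_inertia_unitChar_ne_one_of_isResidualPairOver W hp2 hanom hGL hK hpv hpvbar hne hpair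
  have hθ : ∀ σ : absoluteGaloisGroup K, θsub σ ^ (p - 1) = 1 := fun σ ↦ (hpair.pow_sub_one σ).1
  have e := CharResidualSelmerCount.grSelmer_charModule_eq_unrSelmer_of_ramified κ vbar S₀ θsub hθ hτ hne1
  change zpCorank ↥(unrSelmer κ (charModule (∅ : Set (PadicAlgCl p)) θsub) vbar S₀) p =
    zpCorank ↥(grSelmer κ (charModule (∅ : Set (PadicAlgCl p)) θsub) vbar S₀) p
  rw [e]

end Summit.BirchSwinnertonDyer.BirchSwinnertonDyer.Theorems.IndexPlumbingSubNrEqStrict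

end
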